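import Mathlib

/-!
# Venture HSemireg — THEOREM T (point pair, 1/2): the two-block wedge model, pointPair, Tset

HONEST FRAMING. Part of the Lean index of the computation cell `pub-hsemireg` (seat p3; Sunday enclosure of the
FORMULA-N kernel assets of seats th-7 / th-6, ENCLOSURE-PLAN-p3.md).  Finite-dimensional exterior algebra over a field ONLY:
no variety, no cohomology theory, no semiregularity map is constructed here; nothing here says that HC / HC_CM / HC_AV holds;
no Literature fact is declared or used.  The geometric DICTIONARY (why these ranks are the `HT`-side box ranks of the cell's
STRUCTURE.md §1 / theory/FORMULA-N.md) lives in theory/FORMULA-N-th7.md PART B §A.3 / §N and is NOT asserted in Lean.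

THEOREM T, the POINT-PAIR case (FORMULA-N PART A §2.2; th-7 theory/th7/PointPairRank.lean 1926bdf07cba996d l.17–247), file
1 of 2 — the Fin-indexed wedge model of ONE factor: generators `I n := Fin (n+n)`, blocks `X` (indices `< n`, the polyvectors `∂_a`)
and `Y` (the (0,1)-forms `dz̄_a`), monomial basis `B K n s`, the point-pair class `pointPair a c := a • B X + c • B Y` (model of
`a·1 + c·[pt]`, e.g. `ch(I_p)` up to units, in the spinor presentation of PART B §A.3), `wedgeMap k v := θ ↦ θ ∧ v` on `⋀^k`,
products of monomials with the two blocks, and the index set `Tset n k` of the two K-isotypic pieces with `|Tset| = 2·C(n,k)`.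
th-7's statements and proofs, unchanged (namespace `HSemiregPointPair` ↦ `Summit.Ventures.HSemireg.WedgePair`).  This Fin-indexed
`B K n s` is NOT the generic `Wedge.B K I s` of `WedgeModel.lean` (different signature; kept apart by namespace).
-/

open Module Set Set.powersetCard

namespace Summit.Ventures.HSemireg.WedgePair

variable (K : Type*) [Field K] (n : ℕ)

/-- index type of the `2n` generators: the first `n` model the polyvectors `∂_a` (block `X`), the last `n`
the `(0,1)`-forms `dz̄_a` (block `Y`). -/
abbrev I : Type := Fin (n + n)

/-- `N = V ⊕ V̄^*`, the free module on the generators. -/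
abbrev N : Type _ := I n → K

/-- the exterior algebra `⋀ N` (= `HT^•` of the model, and also the home of the classes). -/
abbrev HT : Type _ := ExteriorAlgebra K (N K n)

/-- the standard basis of `N`. -/
noncomputable def b : Basis (I n) K (N K n) := Pi.basisFun K (I n)

/-- the monomial basis of the exterior algebra, indexed by finsets of generators. -/
noncomputable def B : Basis (Finset (I n)) K (HT K n) := (b K n).ExteriorAlgebra

/-- the `X` block. -/
def Xset : Finset (I n) := Finset.univ.filter fun i => (i : ℕ) < n

/-- the `Y` block. -/
def Yset : Finset (I n) := Finset.univ.filter fun i => n ≤ (i : ℕ)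

/-- membership in the `X` block: index `< n`. -/
lemma mem_Xset {i : I n} : i ∈ Xset n ↔ (i : ℕ) < n := by simp [Xset]

/-- membership in the `Y` block: index `≥ n`. -/
lemma mem_Yset {i : I n} : i ∈ Yset n ↔ n ≤ (i : ℕ) := by simp [Yset]

/-- the blocks `X` and `Y` are disjoint. -/
lemma disjoint_XY : Disjoint (Xset n) (Yset n) := by
  rw [Finset.disjoint_left]
  intro i hx hy
  rw [mem_Xset] at hx
  rw [mem_Yset] at hy
  omega

/-- every index is in `X` or in `Y`. -/
lemma mem_X_or_Y (i : I n) : i ∈ Xset n ∨ i ∈ Yset n := by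
  rw [mem_Xset, mem_Yset]; omega

/-- `X ∪ Y = univ`. -/
lemma Xset_union_Yset : Xset n ∪ Yset n = Finset.univ := by
  ext i; simpa using mem_X_or_Y n i

/-- `|X| = n`. -/
lemma card_Xset : (Xset n).card = n := by
  have h : (Xset n) = Finset.univ.map (Fin.castAddEmb n) := by
    ext i
    simp only [mem_Xset, Finset.mem_map, Finset.mem_univ, true_and, Fin.castAddEmb_apply]
    constructor
    · intro hi; exact ⟨⟨i, hi⟩, Fin.ext rfl⟩
    · rintro ⟨j, rfl⟩; simp
  rw [h, Finset.card_map, Finset.card_univ, Fintype.card_fin]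

/-- `|Y| = n`. -/
lemma card_Yset : (Yset n).card = n := by
  have h : (Yset n) = Finset.univ.map (Fin.natAddEmb n) := by
    ext i
    simp only [mem_Yset, Finset.mem_map, Finset.mem_univ, true_and, Fin.natAddEmb_apply]
    constructor
    · intro hi
      refine ⟨⟨i - n, by omega⟩, Fin.ext ?_⟩
      simp; omega
    · rintro ⟨j, rfl⟩; simp
  rw [h, Finset.card_map, Finset.card_univ, Fintype.card_fin]

/-- the `X` block as an element of `powersetCard`. -/
def Xpc : powersetCard (I n) n := ⟨Xset n, by rw [mem_iff, card_Xset]⟩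

/-- the `Y` block as an element of `powersetCard`. -/
def Ypc : powersetCard (I n) n := ⟨Yset n, by rw [mem_iff, card_Yset]⟩

/-- coercion of `Xpc` is `Xset`. -/
@[simp] lemma coe_Xpc : ((Xpc n : powersetCard (I n) n) : Finset (I n)) = Xset n := rfl
/-- coercion of `Ypc` is `Yset`. -/
@[simp] lemma coe_Ypc : ((Ypc n : powersetCard (I n) n) : Finset (I n)) = Yset n := rfl

/-- the point-pair class `a·E_X + c·E_Y` (model of `a·1 + c·pt`). -/
noncomputable def pointPair (a c : K) : HT K n :=
  a • B K n (Xpc n : powersetCard (I n) n) + c • B K n (Ypc n : powersetCard (I n) n)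

/-- `θ ↦ θ ∧ v` on the `k`-th exterior power (values in the whole exterior algebra). -/
noncomputable def wedgeMap (k : ℕ) (v : HT K n) : (⋀[K]^k (N K n)) →ₗ[K] HT K n :=
  (LinearMap.mulRight K v) ∘ₗ (⋀[K]^k (N K n)).subtype

/-! ### The range is spanned by the images of the monomial basis of `⋀^k`. -/

/-- `⋀^k` is the span of the monomials of cardinality `k`. -/
lemma exteriorPower_eq_span (k : ℕ) :
    (⋀[K]^k (N K n) : Submodule K (HT K n)) =
      Submodule.span K (Set.range fun s : powersetCard (I n) k => (B K n s : HT K n)) := by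
  have h1 : (⋀[K]^k (N K n) : Submodule K (HT K n)) =
      Submodule.map (⋀[K]^k (N K n)).subtype ⊤ := by simp
  rw [h1, ← ((b K n).exteriorPower k).span_eq, Submodule.map_span, ← Set.range_comp]
  congr 1
  ext s
  simp [B, ExteriorAlgebra.basis_eq_coe_basis]

/-- the range of `θ ↦ θ ∧ v` on `⋀^k` is spanned by the `E_s ∧ v`, `|s| = k`. -/
lemma range_wedgeMap (k : ℕ) (v : HT K n) :
    LinearMap.range (wedgeMap K n k v) =
      Submodule.span K (Set.range fun s : powersetCard (I n) k => (B K n s : HT K n) * v) := by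
  rw [wedgeMap, LinearMap.range_comp, Submodule.range_subtype, exteriorPower_eq_span,
    Submodule.map_span, ← Set.range_comp]
  rfl

/-! ### Monomial products with the two blocks -/

variable {n}

/-- the monomial `B s` as Mathlib's basis vector at `pc s`. -/
lemma B_apply_pc {k : ℕ} (s : powersetCard (I n) k) :
    B K n s = (b K n).ExteriorAlgebra (s : Finset (I n)) := rfl

/-- overlapping monomials multiply to zero. -/
lemma B_mul_of_not_disjoint {k m : ℕ} (s : powersetCard (I n) k) (t : powersetCard (I n) m)
    (h : ¬ Disjoint s.val t.val) : B K n s * B K n t = 0 :=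
  ExteriorAlgebra.basis_mul_of_not_disjoint (b K n) s t h

/-- disjoint monomials multiply to a unit times the union monomial. -/
lemma B_mul_of_disjoint {k m : ℕ} (s : powersetCard (I n) k) (t : powersetCard (I n) m)
    (h : Disjoint s.val t.val) :
    B K n s * B K n t = (permOfDisjoint h).sign • B K n (disjUnion h : Finset (I n)) :=
  ExteriorAlgebra.basis_mul_of_disjoint (b K n) s t h

/-- coercion of a `disjUnion` in `powersetCard` is the union. -/
lemma coe_disjUnion_eq_union {k m : ℕ} {s : powersetCard (I n) k} {t : powersetCard (I n) m}
    (h : Disjoint s.val t.val) : (disjUnion h : Finset (I n)) = s.val ∪ t.val := by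
  rw [coe_disjUnion, Finset.disjUnion_eq_union]

/-- `ε • ε • x = x` for a unit `ε = ±1` of `ℤ`. -/
lemma units_smul_smul_self (u : ℤˣ) (x : HT K n) : u • (u • x) = x := by
  rw [smul_smul, Int.units_mul_self, one_smul]

/-- `ε • x ∈ P ↔ x ∈ P` for a unit `ε` of `ℤ`. -/
lemma units_smul_mem {p : Submodule K (HT K n)} {x : HT K n} (u : ℤˣ) (hx : x ∈ p) :
    u • x ∈ p := by
  rcases Int.units_eq_one_or u with rfl | rfl
  · simpa using hx
  · rw [Units.neg_smul, one_smul]; exact p.neg_mem hx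

/-- subsets of the generators: disjoint from `X` iff contained in `Y`. -/
lemma disjoint_X_iff_subset_Y {s : Finset (I n)} : Disjoint s (Xset n) ↔ s ⊆ Yset n := by
  rw [Finset.disjoint_left]
  constructor
  · intro h i hi
    rcases mem_X_or_Y n i with hx | hy
    · exact (h hi hx).elim
    · exact hy
  · intro h i hi hx
    exact Finset.disjoint_left.mp (disjoint_XY n) hx (h hi)

/-- `s` is disjoint from `Y` iff `s ⊆ X`. -/
lemma disjoint_Y_iff_subset_X {s : Finset (I n)} : Disjoint s (Yset n) ↔ s ⊆ Xset n := by
  rw [Finset.disjoint_left]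
  constructor
  · intro h i hi
    rcases mem_X_or_Y n i with hx | hy
    · exact hx
    · exact (h hi hy).elim
  · intro h i hi hy
    exact Finset.disjoint_left.mp (disjoint_XY n) (h hi) hy

/-- a non-empty subset of `t` is not disjoint from `t`. -/
lemma not_disjoint_of_subset_of_nonempty {s t : Finset (I n)} (hst : s ⊆ t) (hs : s.Nonempty) :
    ¬ Disjoint s t := by
  rw [Finset.not_disjoint_iff]
  obtain ⟨i, hi⟩ := hs
  exact ⟨i, hi, hst hi⟩

/-- a set of positive cardinality is non-empty. -/
lemma nonempty_of_pc {k : ℕ} (hk : 0 < k) (s : powersetCard (I n) k) : (s : Finset (I n)).Nonempty := by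
  rw [← Finset.card_pos, card_eq s]; exact hk

/-- the image of a basis monomial under `θ ↦ θ ∧ (a E_X + c E_Y)`. -/
lemma B_mul_pointPair {k : ℕ} (s : powersetCard (I n) k) (a c : K) :
    B K n s * pointPair K n a c =
      a • (B K n s * B K n (Xpc n : powersetCard (I n) n)) +
      c • (B K n s * B K n (Ypc n : powersetCard (I n) n)) := by
  simp only [pointPair, mul_add, mul_smul_comm]

/-- a monomial of cardinality `k` lies in `⋀^k`. -/
lemma B_mem_exteriorPower {k : ℕ} (s : powersetCard (I n) k) :
    (B K n s : HT K n) ∈ ⋀[K]^k (N K n) := by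
  rw [B_apply_pc, ExteriorAlgebra.basis_eq_coe_basis]; exact Submodule.coe_mem _

/-- `wedgeMap k v θ = θ * v`. -/
lemma wedgeMap_apply {k : ℕ} (v : HT K n) (x : ⋀[K]^k (N K n)) :
    wedgeMap K n k v x = (x : HT K n) * v := rfl

/-! ### The case `0 < k < n`: the image monomials are the `E_{s ∪ X}` (`s ⊆ Y`) and `E_{s ∪ Y}` (`s ⊆ X`). -/

variable (n) in
/-- the index set of the image monomials in degree `k`. -/
def Tset (k : ℕ) : Finset (Finset (I n)) :=
  ((Yset n).powersetCard k).image (fun s => s ∪ Xset n) ∪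
    ((Xset n).powersetCard k).image (fun s => s ∪ Yset n)

/-- `s ∪ X ∈ Tset` for `s ⊆ Y`, `|s| = k`. -/
lemma mem_Tset_of_subset_Y {k : ℕ} {s : Finset (I n)} (hs : s ⊆ Yset n) (hc : s.card = k) :
    s ∪ Xset n ∈ Tset n k := by
  rw [Tset, Finset.mem_union]; left
  exact Finset.mem_image.mpr ⟨s, Finset.mem_powersetCard.mpr ⟨hs, hc⟩, rfl⟩

/-- `s ∪ Y ∈ Tset` for `s ⊆ X`, `|s| = k`. -/
lemma mem_Tset_of_subset_X {k : ℕ} {s : Finset (I n)} (hs : s ⊆ Xset n) (hc : s.card = k) :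
    s ∪ Yset n ∈ Tset n k := by
  rw [Tset, Finset.mem_union]; right
  exact Finset.mem_image.mpr ⟨s, Finset.mem_powersetCard.mpr ⟨hs, hc⟩, rfl⟩

/-- `|Tset| = 2·C(n,k)` for `0 < k < n` (the two families are disjoint). -/
lemma card_Tset {k : ℕ} (hkn : k < n) : (Tset n k).card = 2 * n.choose k := by
  have injY : Set.InjOn (fun s : Finset (I n) => s ∪ Xset n) ↑((Yset n).powersetCard k) := by
    intro s hs s' hs' h
    have hsY := (Finset.mem_powersetCard.mp (Finset.mem_coe.mp hs)).1
    have hs'Y := (Finset.mem_powersetCard.mp (Finset.mem_coe.mp hs')).1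
    have hd : Disjoint s (Xset n) := disjoint_X_iff_subset_Y.mpr hsY
    have hd' : Disjoint s' (Xset n) := disjoint_X_iff_subset_Y.mpr hs'Y
    simp only at h
    rw [← Finset.union_sdiff_cancel_right hd, h, Finset.union_sdiff_cancel_right hd']
  have injX : Set.InjOn (fun s : Finset (I n) => s ∪ Yset n) ↑((Xset n).powersetCard k) := by
    intro s hs s' hs' h
    have hsX := (Finset.mem_powersetCard.mp (Finset.mem_coe.mp hs)).1
    have hs'X := (Finset.mem_powersetCard.mp (Finset.mem_coe.mp hs')).1
    have hd : Disjoint s (Yset n) := disjoint_Y_iff_subset_X.mpr hsX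
    have hd' : Disjoint s' (Yset n) := disjoint_Y_iff_subset_X.mpr hs'X
    simp only at h
    rw [← Finset.union_sdiff_cancel_right hd, h, Finset.union_sdiff_cancel_right hd']
  have hdisj : Disjoint (((Yset n).powersetCard k).image (fun s => s ∪ Xset n))
      (((Xset n).powersetCard k).image (fun s => s ∪ Yset n)) := by
    rw [Finset.disjoint_left]
    intro t ht ht'
    obtain ⟨s, hs, rfl⟩ := Finset.mem_image.mp ht
    obtain ⟨s', hs', h⟩ := Finset.mem_image.mp ht'
    have hsY := (Finset.mem_powersetCard.mp hs).1
    have hsc := (Finset.mem_powersetCard.mp hs).2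
    -- Y ⊆ s' ∪ Y = s ∪ X, and X ⊆ s ∪ X, so s ∪ X = univ, card n + n; but card (s ∪ X) = k + n
    have hXsub : Xset n ⊆ s ∪ Xset n := Finset.subset_union_right
    have hYsub : Yset n ⊆ s ∪ Xset n := by rw [← h]; exact Finset.subset_union_right
    have huniv : s ∪ Xset n = Finset.univ := by
      apply Finset.eq_univ_of_forall
      intro i
      rcases mem_X_or_Y n i with hx | hy
      · exact hXsub hx
      · exact hYsub hy
    have hcard : (s ∪ Xset n).card = k + n := by
      rw [Finset.card_union_of_disjoint (disjoint_X_iff_subset_Y.mpr hsY), hsc, card_Xset]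
    rw [huniv, Finset.card_univ, Fintype.card_fin] at hcard
    omega
  rw [Tset, Finset.card_union_of_disjoint hdisj, Finset.card_image_of_injOn injY,
    Finset.card_image_of_injOn injX, Finset.card_powersetCard, Finset.card_powersetCard, card_Xset,
    card_Yset]
  ring

end Summit.Ventures.HSemireg.WedgePair
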